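import Summits.KontsevichZagierPeriods.KontsevichZagierPeriods.Theorems.SoloInformedKZChain
import Summits.KontsevichZagierPeriods.KontsevichZagierPeriods.Theorems.SoloInformedAlgebraicParameterTransfer
import Summits.KontsevichZagierPeriods.KontsevichZagierPeriods.Theorems.SoloInformedAlgebraicCoefficientDescent
import HarnessLib
import HarnessLib.Audit

/-!
# SoloInformed — honest chains without catalyst, I: zero representations, points, cubes

Solo programme `solo-KontsevichZagierPeriods-informed`, session s262 (file 3; THEOREM CH,
part 3a).

`SoloInformedKZChain` proved `KZ.Equivalent r r' ↔ ∃ t, {r} + t ~ {r'} + t` (honest chains of the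
four moves after adjoining a common auxiliary family `t`).  This file and the next remove the
catalyst `t` for representations with NONEMPTY domains.  The device: ZERO REPRESENTATIONS
`Z σ := [σ, 0]` can be created and destroyed freely next to any representation with nonempty
domain, and from the zero representation of a point every finite family `{u} + N(u)` (`u`
arbitrary, `N(u)` a "neutraliser" depending only on `u`) can be produced by honest moves.  Here:

* `soloInformedZRep σ` and the honest steps DUPLICATE `{s} → {s, Z s.domain}` (1b), SPLIT
  `{Z u.domain} → {u, −u}` (1b), SPAWN A POINT `{Z σ} → {Z {p}, Z σ}` (1a, `p ∈ σ` algebraic,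
  positive dimension), BAND `{Z (band τ c d)} → {Z τ}` (3 with `F = 0`);
* `soloInformed_chain_point_anchor` — `{Z {p}} ~ {P₀}` for an algebraic point `p`, where
  `P₀ = soloInformedAnchor = [ℝ⁰, 0]`; `soloInformed_chain_spawn` — `{s} ~ {s, P₀}` for every `s`
  with nonempty domain;
* `soloInformedSymCube m = [-1, 1]ᵐ` and `soloInformed_chain_symCube_anchor` —
  `{Z [-1,1]ᵐ} ~ {P₀}`.

References: [Kontsevich–Zagier 2001, §1.2]; this work (`nl-elimination.md`, REMARK NF.4).
-/

noncomputable section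

namespace Summit.KontsevichZagierPeriods.KontsevichZagierPeriods.Theorems

open Set MeasureTheory MvPolynomial
open Literature.ModelTheory.ExponentialFields
open Literature.NumberTheory.Transcendental Literature.NumberTheory.Transcendental.KZ

/-! ### Zero representations and the two (1b)-steps -/

/-- **The zero representation** `Z σ = [σ, 0]` on a `ℚ`-semialgebraic set `σ`.
[Kontsevich–Zagier 2001, §1.1] -/
def soloInformedZRep {n : ℕ} (σ : Set (Fin n → ℝ)) (hσ : IsSemialgebraic ℚ σ) :
    IntegralRep n where
  domain := σ
  integrand := fun _ => 0
  isSemialgebraic_domain := hσ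
  isSemialgebraicFunOn_integrand := by simpa using isSemialgebraicFunOn_ratCast hσ 0
  integrableOn := integrableOn_zero

/-- The domain of `Z σ` is `σ`. [folklore] -/
@[simp] theorem soloInformedZRep_domain {n : ℕ} (σ : Set (Fin n → ℝ))
    (hσ : IsSemialgebraic ℚ σ) : (soloInformedZRep σ hσ).domain = σ := rfl

/-- The integrand of `Z σ` is `0`. [folklore] -/
@[simp] theorem soloInformedZRep_integrand {n : ℕ} (σ : Set (Fin n → ℝ))
    (hσ : IsSemialgebraic ℚ σ) (x : Fin n → ℝ) : (soloInformedZRep σ hσ).integrand x = 0 := rfl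

/-- `Z σ` only depends on the set `σ`. [folklore] -/
theorem soloInformedZRep_congr {n : ℕ} {σ σ' : Set (Fin n → ℝ)} (hσ : IsSemialgebraic ℚ σ)
    (hσ' : IsSemialgebraic ℚ σ') (h : σ = σ') :
    soloInformedZRep σ hσ = soloInformedZRep σ' hσ' := by
  subst h
  rfl

/-- `Z σ` is a rational representation (`0 = 0 / 1`). [Kontsevich–Zagier 2001, §1.1] -/
theorem soloInformedZRep_isRational {n : ℕ} (σ : Set (Fin n → ℝ))
    (hσ : IsSemialgebraic ℚ σ) : (soloInformedZRep σ hσ).IsRational :=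
  ⟨0, 1, fun x _ => by simp, fun x _ => by simp⟩

/-- `Z σ` has value `0`. [folklore] -/
theorem soloInformedZRep_value {n : ℕ} (σ : Set (Fin n → ℝ)) (hσ : IsSemialgebraic ℚ σ) :
    (soloInformedZRep σ hσ).value = 0 := by
  simp [IntegralRep.value]

/-- A two-element family is the sum of two singletons. [folklore] -/
theorem soloInformed_pair_eq {X : Type*} (a b : X) : ({a, b} : Multiset X) = {a} + {b} := by
  rw [Multiset.insert_eq_cons, Multiset.singleton_add]

/-- **DUPLICATE (move 1b)**: `{s} → {s, Z s.domain}` is an honest step (`f = f + 0`).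
[Kontsevich–Zagier 2001, §1.2, rule (1)] -/
theorem soloInformed_dup_mem_KZSteps {n : ℕ} (s : IntegralRep n) :
    (({(⟨n, s⟩ : Σ n, IntegralRep n)} : Multiset (Σ n, IntegralRep n)),
      ({(⟨n, s⟩ : Σ n, IntegralRep n),
        ⟨n, soloInformedZRep s.domain s.isSemialgebraic_domain⟩} : Multiset (Σ n, IntegralRep n)))
      ∈ soloInformedKZSteps := by
  refine Or.inl (Or.inl (Or.inr ⟨n, s, s, soloInformedZRep s.domain s.isSemialgebraic_domain,
    rfl, rfl, ?_, rfl⟩))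
  intro x _
  simp

/-- **SPLIT (move 1b)**: `{Z u.domain} → {u, −u}` is an honest step (`0 = f + (−f)`).
[Kontsevich–Zagier 2001, §1.2, rule (1)] -/
theorem soloInformed_split_mem_KZSteps {n : ℕ} (u : IntegralRep n) :
    (({(⟨n, soloInformedZRep u.domain u.isSemialgebraic_domain⟩ : Σ n, IntegralRep n)} :
        Multiset (Σ n, IntegralRep n)),
      ({(⟨n, u⟩ : Σ n, IntegralRep n), ⟨n, u.neg⟩} : Multiset (Σ n, IntegralRep n)))
      ∈ soloInformedKZSteps := by
  refine Or.inl (Or.inl (Or.inr ⟨n, soloInformedZRep u.domain u.isSemialgebraic_domain, u,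
    u.neg, rfl, rfl, ?_, rfl⟩))
  intro x _
  simp [IntegralRep.neg]

/-- The chain `{s} ~ {s} + {Z s.domain}`. [Kontsevich–Zagier 2001, §1.2, rule (1)] -/
theorem soloInformed_chain_dup {n : ℕ} (s : IntegralRep n) :
    SoloInformedMoveChain soloInformedKZSteps
      ({(⟨n, s⟩ : Σ n, IntegralRep n)} : Multiset (Σ n, IntegralRep n))
      ({(⟨n, s⟩ : Σ n, IntegralRep n)} +
        {⟨n, soloInformedZRep s.domain s.isSemialgebraic_domain⟩}) := by
  rw [← soloInformed_pair_eq]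
  exact SoloInformedMoveChain.of_mem (soloInformed_dup_mem_KZSteps s)

/-- The chain `{Z u.domain} ~ {u} + {−u}`. [Kontsevich–Zagier 2001, §1.2, rule (1)] -/
theorem soloInformed_chain_split {n : ℕ} (u : IntegralRep n) :
    SoloInformedMoveChain soloInformedKZSteps
      ({(⟨n, soloInformedZRep u.domain u.isSemialgebraic_domain⟩ : Σ n, IntegralRep n)} :
        Multiset (Σ n, IntegralRep n))
      ({(⟨n, u⟩ : Σ n, IntegralRep n)} + {⟨n, u.neg⟩}) := by
  rw [← soloInformed_pair_eq]
  exact SoloInformedMoveChain.of_mem (soloInformed_split_mem_KZSteps u)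

/-! ### Algebraic points -/

/-- **A point with algebraic coordinates is a `ℚ`-semialgebraic singleton.**
[Basu–Pollack–Roy 2006, Cor. 2.78] -/
theorem soloInformed_isSemialgebraic_singleton {n : ℕ} {p : Fin n → ℝ}
    (hp : ∀ i, IsAlgebraic ℚ (p i)) : IsSemialgebraic ℚ ({p} : Set (Fin n → ℝ)) := by
  have hP : IsSemialgebraic ℚ {w : Fin n ⊕ Fin n → ℝ |
      (fun (c : Fin n → ℝ) (x : Fin n → ℝ) => ∀ i, x i = c i) (fun j => w (Sum.inl j))
        fun i => w (Sum.inr i)} := by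
    have hset : {w : Fin n ⊕ Fin n → ℝ |
        (fun (c : Fin n → ℝ) (x : Fin n → ℝ) => ∀ i, x i = c i) (fun j => w (Sum.inl j))
          fun i => w (Sum.inr i)} = ⋂ i ∈ (Finset.univ : Finset (Fin n)),
        {w : Fin n ⊕ Fin n → ℝ | aeval w (X (Sum.inr i) - X (Sum.inl i) :
          MvPolynomial (Fin n ⊕ Fin n) ℚ) = 0} := by
      ext w
      simp [sub_eq_zero]
    rw [hset]
    exact IsSemialgebraic.biInter _ _ fun i _ => isSemialgebraic_setOf_eval_eq_zero _
  have h := soloInformed_isSemialgebraic_rat_of_algebraic_instance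
    (P := fun (c : Fin n → ℝ) (x : Fin n → ℝ) => ∀ i, x i = c i) hP hp
  convert h using 1
  ext x
  simp only [mem_singleton_iff, mem_setOf_eq, funext_iff]

/-- A vector is determined by its initial part and its last coordinate. [folklore] -/
theorem soloInformed_eq_of_init_eq {k : ℕ} {z p : Fin (k + 1) → ℝ}
    (h₁ : Fin.init z = Fin.init p) (h₂ : z (Fin.last k) = p (Fin.last k)) : z = p := by
  calc z = Fin.snoc (Fin.init z) (z (Fin.last k)) := (Fin.snoc_init_self z).symm
    _ = Fin.snoc (Fin.init p) (p (Fin.last k)) := by rw [h₁, h₂]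
    _ = p := Fin.snoc_init_self p

/-- **SPAWN A POINT (move 1a)**: for `p ∈ σ ⊆ ℝᵏ⁺¹` with algebraic coordinates,
`{Z σ} → {Z {p}, Z σ}` is an honest step (`σ = {p} ∪ σ`, `vol ({p} ∩ σ) = 0`).
[Kontsevich–Zagier 2001, §1.2, rule (1)] -/
theorem soloInformed_spawn_mem_KZSteps {k : ℕ} {σ : Set (Fin (k + 1) → ℝ)}
    (hσ : IsSemialgebraic ℚ σ) {p : Fin (k + 1) → ℝ} (hp : p ∈ σ)
    (halg : ∀ i, IsAlgebraic ℚ (p i)) :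
    (({(⟨k + 1, soloInformedZRep σ hσ⟩ : Σ n, IntegralRep n)} : Multiset (Σ n, IntegralRep n)),
      ({(⟨k + 1, soloInformedZRep {p} (soloInformed_isSemialgebraic_singleton halg)⟩ :
          Σ n, IntegralRep n), ⟨k + 1, soloInformedZRep σ hσ⟩} : Multiset (Σ n, IntegralRep n)))
      ∈ soloInformedKZSteps := by
  refine Or.inl (Or.inl (Or.inl ⟨k + 1, soloInformedZRep σ hσ,
    soloInformedZRep {p} (soloInformed_isSemialgebraic_singleton halg),
    soloInformedZRep σ hσ, ?_, ?_, fun _ _ => rfl, fun _ _ => rfl, rfl⟩))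
  · show σ = {p} ∪ σ
    rw [singleton_union, insert_eq_of_mem hp]
  · show volume (({p} : Set (Fin (k + 1) → ℝ)) ∩ σ) = 0
    exact measure_mono_null inter_subset_left (measure_singleton p)

/-! ### Bands and move (3) with `F = 0` -/

/-- The band `{z | init z ∈ τ, c ≤ z_last ≤ d}` over `τ` between two constants.
[Kontsevich–Zagier 2001, §1.2, rule (3)] -/
def soloInformedZSlab {m : ℕ} (τ : Set (Fin m → ℝ)) (c d : ℝ) : Set (Fin (m + 1) → ℝ) :=
  {z | Fin.init z ∈ τ ∧ c ≤ z (Fin.last m) ∧ z (Fin.last m) ≤ d}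

/-- Bands with rational bounds over `ℚ`-semialgebraic sets are `ℚ`-semialgebraic.
[BCR 1998, §2.1] -/
theorem soloInformed_isSemialgebraic_zslab {m : ℕ} {τ : Set (Fin m → ℝ)}
    (hτ : IsSemialgebraic ℚ τ) (c d : ℚ) :
    IsSemialgebraic ℚ (soloInformedZSlab τ (c : ℝ) (d : ℝ)) := by
  have h1 : IsSemialgebraic ℚ {z : Fin (m + 1) → ℝ | (c : ℝ) ≤ z (Fin.last m)} := by
    simpa using isSemialgebraic_setOf_eval_le (R := ℝ) (C c : MvPolynomial (Fin (m + 1)) ℚ)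
      (X (Fin.last m))
  have h2 : IsSemialgebraic ℚ {z : Fin (m + 1) → ℝ | z (Fin.last m) ≤ (d : ℝ)} := by
    simpa using isSemialgebraic_setOf_eval_le (R := ℝ) (X (Fin.last m))
      (C d : MvPolynomial (Fin (m + 1)) ℚ)
  convert (hτ.setOf_init_mem.inter h1).inter h2 using 1
  ext z
  simp only [soloInformedZSlab, mem_setOf_eq, mem_inter_iff, and_assoc]

/-- **BAND (move 3 with `F = 0`)**: `{Z (band τ c d)} → {Z τ}` is an honest step whenever the
constant functions `c ≤ d` are `ℚ`-semialgebraic on `τ` and the band is `ℚ`-semialgebraic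
(`∂ₜ 0 = 0`, `0(·, d) − 0(·, c) = 0`). [Kontsevich–Zagier 2001, §1.2, rule (3)] -/
theorem soloInformed_zslab_mem_KZSteps {m : ℕ} {τ : Set (Fin m → ℝ)} (hτ : IsSemialgebraic ℚ τ)
    {c d : ℝ} (hcd : c ≤ d) (hc : IsSemialgebraicFunOn ℚ τ fun _ => c)
    (hd : IsSemialgebraicFunOn ℚ τ fun _ => d) (hb : IsSemialgebraic ℚ (soloInformedZSlab τ c d)) :
    (({(⟨m + 1, soloInformedZRep (soloInformedZSlab τ c d) hb⟩ : Σ n, IntegralRep n)} :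
        Multiset (Σ n, IntegralRep n)),
      ({(⟨m, soloInformedZRep τ hτ⟩ : Σ n, IntegralRep n)} : Multiset (Σ n, IntegralRep n)))
      ∈ soloInformedKZSteps := by
  refine Or.inr ⟨m, soloInformedZRep (soloInformedZSlab τ c d) hb, soloInformedZRep τ hτ,
    (fun _ => c), (fun _ => d), (fun _ => 0), ?_, hc, hd, fun _ _ => hcd, rfl, ?_, ?_, ?_, rfl⟩
  · simpa using isSemialgebraicFunOn_ratCast hb 0
  · intro x _
    exact continuousOn_const
  · intro x _ t _
    exact hasDerivAt_const t (0 : ℝ)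
  · intro x _
    simp

/-- The one-point band over `init p` at height `p_last` is `{p}`. [folklore] -/
theorem soloInformed_zslab_init_eq {k : ℕ} (p : Fin (k + 1) → ℝ) :
    soloInformedZSlab {Fin.init p} (p (Fin.last k)) (p (Fin.last k)) = {p} := by
  ext z
  simp only [soloInformedZSlab, mem_setOf_eq, mem_singleton_iff]
  constructor
  · rintro ⟨h1, h2, h3⟩
    exact soloInformed_eq_of_init_eq h1 (le_antisymm h3 h2)
  · rintro rfl
    exact ⟨rfl, le_rfl, le_rfl⟩

/-- The constant function `p_last` on `{init p}` is `ℚ`-semialgebraic for algebraic `p` (its graph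
is `{p}`). [Basu–Pollack–Roy 2006, Cor. 2.78] -/
theorem soloInformed_isSemialgebraicFunOn_const_init {k : ℕ} {p : Fin (k + 1) → ℝ}
    (hp : ∀ i, IsAlgebraic ℚ (p i)) :
    IsSemialgebraicFunOn ℚ ({Fin.init p} : Set (Fin k → ℝ)) (fun _ => p (Fin.last k)) := by
  rw [isSemialgebraicFunOn_iff]
  convert soloInformed_isSemialgebraic_singleton hp using 1
  ext z
  simp only [mem_setOf_eq, mem_singleton_iff]
  constructor
  · rintro ⟨h1, h2⟩
    exact soloInformed_eq_of_init_eq h1 h2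
  · rintro rfl
    exact ⟨rfl, rfl⟩

/-- Initial parts of algebraic points are algebraic. [folklore] -/
theorem soloInformed_init_isAlgebraic {k : ℕ} {p : Fin (k + 1) → ℝ}
    (hp : ∀ i, IsAlgebraic ℚ (p i)) : ∀ i, IsAlgebraic ℚ (Fin.init p i) :=
  fun i => hp (Fin.castSucc i)

/-- **POINT DESCENT (move 3)**: `{Z {p}} → {Z {init p}}` (dimension `k + 1 → k`) is an honest step
for an algebraic point `p`. [Kontsevich–Zagier 2001, §1.2, rule (3)] -/
theorem soloInformed_pointDescent_mem_KZSteps {k : ℕ} {p : Fin (k + 1) → ℝ}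
    (hp : ∀ i, IsAlgebraic ℚ (p i)) :
    (({(⟨k + 1, soloInformedZRep {p} (soloInformed_isSemialgebraic_singleton hp)⟩ :
          Σ n, IntegralRep n)} : Multiset (Σ n, IntegralRep n)),
      ({(⟨k, soloInformedZRep {Fin.init p}
          (soloInformed_isSemialgebraic_singleton (soloInformed_init_isAlgebraic hp))⟩ :
          Σ n, IntegralRep n)} : Multiset (Σ n, IntegralRep n))) ∈ soloInformedKZSteps := by
  have hb : IsSemialgebraic ℚ (soloInformedZSlab {Fin.init p} (p (Fin.last k)) (p (Fin.last k))) := by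
    rw [soloInformed_zslab_init_eq]
    exact soloInformed_isSemialgebraic_singleton hp
  have h := soloInformed_zslab_mem_KZSteps
    (soloInformed_isSemialgebraic_singleton (soloInformed_init_isAlgebraic hp)) le_rfl
    (soloInformed_isSemialgebraicFunOn_const_init hp)
    (soloInformed_isSemialgebraicFunOn_const_init hp) hb
  rwa [soloInformedZRep_congr hb (soloInformed_isSemialgebraic_singleton hp)
    (soloInformed_zslab_init_eq p)] at h

/-! ### The anchor `P₀ = [ℝ⁰, 0]` and chains down to it -/

/-- **The anchor** `P₀ = [ℝ⁰, 0]`: the zero representation of the one-point space `ℝ⁰`.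
[Kontsevich–Zagier 2001, §1.1] -/
def soloInformedAnchor : IntegralRep 0 :=
  soloInformedZRep univ isSemialgebraic_univ

/-- The anchor has nonempty domain. [folklore] -/
theorem soloInformedAnchor_domain_nonempty : soloInformedAnchor.domain.Nonempty :=
  univ_nonempty

/-- **`{Z {p}} ~ {P₀}`** for every algebraic point `p ∈ ℝᵏ` (descend `k` times).
[Kontsevich–Zagier 2001, §1.2, rule (3)] -/
theorem soloInformed_chain_point_anchor : ∀ (k : ℕ) (p : Fin k → ℝ)
    (hp : ∀ i, IsAlgebraic ℚ (p i)),
    SoloInformedMoveChain soloInformedKZSteps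
      ({(⟨k, soloInformedZRep {p} (soloInformed_isSemialgebraic_singleton hp)⟩ :
          Σ n, IntegralRep n)} : Multiset (Σ n, IntegralRep n))
      {(⟨0, soloInformedAnchor⟩ : Σ n, IntegralRep n)}
  | 0, p, hp => by
    have hset : ({p} : Set (Fin 0 → ℝ)) = univ := by
      ext x
      simp only [mem_singleton_iff, mem_univ, iff_true]
      exact Subsingleton.elim x p
    rw [soloInformedZRep_congr (soloInformed_isSemialgebraic_singleton hp) isSemialgebraic_univ
      hset]
    exact SoloInformedMoveChain.refl _
  | k + 1, p, hp =>
    (SoloInformedMoveChain.of_mem (soloInformed_pointDescent_mem_KZSteps hp)).trans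
      (soloInformed_chain_point_anchor k (Fin.init p) (soloInformed_init_isAlgebraic hp))

/-- **SPAWN**: next to any representation `s` with NONEMPTY domain the anchor can be created by
honest moves: `{s} ~ {s} + {P₀}`. [Kontsevich–Zagier 2001, §1.2] -/
theorem soloInformed_chain_spawn {n : ℕ} (s : IntegralRep n) (hs : s.domain.Nonempty) :
    SoloInformedMoveChain soloInformedKZSteps
      ({(⟨n, s⟩ : Σ n, IntegralRep n)} : Multiset (Σ n, IntegralRep n))
      ({(⟨n, s⟩ : Σ n, IntegralRep n)} + {⟨0, soloInformedAnchor⟩}) := by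
  have hdup := soloInformed_chain_dup s
  cases n with
  | zero =>
    have hσ : s.domain = univ := by
      ext x
      simp only [mem_univ, iff_true]
      obtain ⟨y, hy⟩ := hs
      rwa [Subsingleton.elim x y]
    rwa [soloInformedZRep_congr s.isSemialgebraic_domain isSemialgebraic_univ hσ] at hdup
  | succ k =>
    obtain ⟨p, hp, halg⟩ := soloInformed_exists_algebraic_point s.isSemialgebraic_domain hs
    have hsp := SoloInformedMoveChain.of_mem (soloInformed_spawn_mem_KZSteps
      s.isSemialgebraic_domain hp halg)
    rw [soloInformed_pair_eq] at hsp
    have hanc := soloInformed_chain_point_anchor (k + 1) p halg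
    -- {s} ~ {s} + {Zσ} ~ {s} + ({Z p} + {Zσ}) = ({s} + {Zσ}) + {Z p} ~ {s} + {Z p} ~ {s} + {P₀}
    refine hdup.trans (((hsp.add_left _).trans ?_))
    rw [show ∀ a b c : Multiset (Σ n, IntegralRep n), a + (b + c) = a + c + b from
      fun a b c => by abel]
    exact (hdup.symm.add_right _).trans (hanc.add_left _)

/-! ### Cubes and the ladder -/

/-- **The cubes** `[-1, 1]ᵐ`, defined recursively as bands so that each rung of the ladder is
literally a move (3). [Kontsevich–Zagier 2001, §1.2] -/
def soloInformedSymCube : (m : ℕ) → Set (Fin m → ℝ)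
  | 0 => univ
  | m + 1 => soloInformedZSlab (soloInformedSymCube m) (-1) 1

/-- Membership in the cube is `-1 ≤ zᵢ ≤ 1` for all `i`. [folklore] -/
theorem soloInformed_mem_symCube_iff : ∀ {m : ℕ} (z : Fin m → ℝ),
    z ∈ soloInformedSymCube m ↔ ∀ i, -1 ≤ z i ∧ z i ≤ 1
  | 0, z => by simp [soloInformedSymCube]
  | m + 1, z => by
    rw [soloInformedSymCube, soloInformedZSlab, mem_setOf_eq, soloInformed_mem_symCube_iff (Fin.init z),
      Fin.forall_fin_succ']
    simp only [Fin.init]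

/-- The cubes are `ℚ`-semialgebraic. [BCR 1998, §2.1] -/
theorem soloInformed_isSemialgebraic_symCube : ∀ m : ℕ, IsSemialgebraic ℚ (soloInformedSymCube m)
  | 0 => isSemialgebraic_univ
  | m + 1 => by
    simpa [soloInformedSymCube] using
      soloInformed_isSemialgebraic_zslab (soloInformed_isSemialgebraic_symCube m) (-1) 1

/-- **LADDER RUNG (move 3)**: `{Z [-1,1]ᵐ⁺¹} → {Z [-1,1]ᵐ}` is an honest step.
[Kontsevich–Zagier 2001, §1.2, rule (3)] -/
theorem soloInformed_ladder_mem_KZSteps (m : ℕ) :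
    (({(⟨m + 1, soloInformedZRep (soloInformedSymCube (m + 1))
          (soloInformed_isSemialgebraic_symCube (m + 1))⟩ : Σ n, IntegralRep n)} :
          Multiset (Σ n, IntegralRep n)),
      ({(⟨m, soloInformedZRep (soloInformedSymCube m) (soloInformed_isSemialgebraic_symCube m)⟩ :
          Σ n, IntegralRep n)} : Multiset (Σ n, IntegralRep n))) ∈ soloInformedKZSteps :=
  soloInformed_zslab_mem_KZSteps (soloInformed_isSemialgebraic_symCube m) (by norm_num)
    (by simpa using isSemialgebraicFunOn_ratCast (soloInformed_isSemialgebraic_symCube m) (-1))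
    (by simpa using isSemialgebraicFunOn_ratCast (soloInformed_isSemialgebraic_symCube m) 1)
    (soloInformed_isSemialgebraic_symCube (m + 1))

/-- **`{Z [-1,1]ᵐ} ~ {P₀}`** (descend the ladder). [Kontsevich–Zagier 2001, §1.2, rule (3)] -/
theorem soloInformed_chain_symCube_anchor : ∀ m : ℕ,
    SoloInformedMoveChain soloInformedKZSteps
      ({(⟨m, soloInformedZRep (soloInformedSymCube m) (soloInformed_isSemialgebraic_symCube m)⟩ :
          Σ n, IntegralRep n)} : Multiset (Σ n, IntegralRep n))
      {(⟨0, soloInformedAnchor⟩ : Σ n, IntegralRep n)}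
  | 0 => SoloInformedMoveChain.refl _
  | m + 1 => (SoloInformedMoveChain.of_mem (soloInformed_ladder_mem_KZSteps m)).trans
      (soloInformed_chain_symCube_anchor m)

/-- **LIFT (move 3)**: `{Z (σ × {0})} → {Z σ}` is an honest step, where
`σ × {0} = band σ 0 0`. [Kontsevich–Zagier 2001, §1.2, rule (3)] -/
theorem soloInformed_lift_mem_KZSteps {m : ℕ} (σ : Set (Fin m → ℝ)) (hσ : IsSemialgebraic ℚ σ) :
    (({(⟨m + 1, soloInformedZRep (soloInformedZSlab σ 0 0)
          (by simpa using soloInformed_isSemialgebraic_zslab hσ 0 0)⟩ : Σ n, IntegralRep n)} :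
          Multiset (Σ n, IntegralRep n)),
      ({(⟨m, soloInformedZRep σ hσ⟩ : Σ n, IntegralRep n)} : Multiset (Σ n, IntegralRep n)))
      ∈ soloInformedKZSteps :=
  soloInformed_zslab_mem_KZSteps hσ le_rfl
    (by simpa using isSemialgebraicFunOn_ratCast hσ 0)
    (by simpa using isSemialgebraicFunOn_ratCast hσ 0) _

end Summit.KontsevichZagierPeriods.KontsevichZagierPeriods.Theorems
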